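import Literature.NumberTheory.Automorphic.ArchKirillovBesselGL2Real
import HarnessLib

/-!
# The Kirillov function of a lowest (or highest) weight vector of `GL₂(K_∞)` along a real place
# (Jacquet–Langlands (1970), §5, Thm. 5.15 for `σ(μ₁, μ₂)`; Bump (1997), §2.8; Gelbart (1975), §4)

Topic `NumberTheory/Automorphic`; namespace `Literature.NumberTheory.Automorphic`. Theorems only (no
definition, no named fact, no instance). Sixth brick of the ARCHIMEDEAN Hecke theory of `GL(2)` in the
tree's Gårding-space vocabulary, the discrete-series companion of `ArchKirillovBesselGL2Real` (weight
zero): the Kirillov function of a vector killed by the LOWERING operator of a real place satisfies a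
FIRST order differential equation and is an elementary function `C u^{(μ+k)/2} e^{iθu}`, supported on
one half-line, whose Mellin transform is a single Gamma function (the factor `Γ_ℂ`-type `L`-factor of
the discrete series, Jacquet–Langlands (1970), Thm. 5.15 / §5: `L(s, σ(μ₁, μ₂)) = Γ_ℂ`-type).

Setting (as in `ArchKirillovODEGL2Real`, `ArchKirillovBesselGL2Real`): `τ` a strongly continuous
Banach representation of `G_∞ = GL₂(K_∞)`, `𝒢` its Gårding space, `w` a REAL place with letters
`H₀, H₁, X⁺, X⁻` (`E_{ij} ⊗ r_w`), `W = X⁺ - X⁻` the rotation generator, and the raising / lowering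
elements of `𝔤𝔩₂(ℝ) = 𝔤𝔩₂(K_w)`

  `R = (H₀ - H₁) + i (X⁺ + X⁻)`,  `L = (H₀ - H₁) - i (X⁺ + X⁻)`,  `[W, R] = 2i R`, `[W, L] = -2i L`

(Bump (1997), §2.2: `R`, `L` raise / lower the `SO(2)`-weight by `2`). Let `ℓ : 𝒢 → ℂ` be linear,
continuous for the `U(𝔤)`-seminorms, with `ℓ(τ(X⁺) u) = θ ℓ(u)`, and let `v ∈ 𝒢` have weight `k`
(`τ(W) v = ik v`) and central parameter `μ` (`τ(H₀) v + τ(H₁) v = μ v`). Put `f(y) = ℓ(τ(exp yH₀) v)`.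

* `hasDerivAt_apply_gardingAct_expGL_of_lowering` — if **`τ(L) v = 0`** (lowest weight vector) then
  **`f'(y) = ((μ + k)/2 + iθ e^{y}) f(y)`**: `f' = ℓ(τ(exp yH₀) τ(H₀) v)` (`ArchKirillovODEGL2Real`) and
  `2τ(H₀) v = (μ + k) v + 2i τ(X⁺) v` from `τ(L) v = 0`, `τ(H₁) v = μ v - τ(H₀) v`,
  `τ(X⁻) v = τ(X⁺) v - ik v`, while `ℓ(τ(exp yH₀) τ(X⁺) u) = e^{y} θ ℓ(τ(exp yH₀) u)`;
  `hasDerivAt_apply_gardingAct_expGL_of_raising` — dually `τ(R) v = 0` gives `f' = ((μ - k)/2 - iθ e^{y}) f`;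
* `exists_eq_const_mul_exp_of_hasDerivAt` — the first order linear equation: `f' = g f`, `G' = g` force
  `f = C e^{G}`; hence (`exists_apply_gardingAct_expGL_eq_of_lowering`)
  **`ℓ(τ(exp yH₀) v) = C exp(((μ + k)/2) y + iθ e^{y})`**, i.e. `ℓ(τ(diag(u,1)_w) v) = C u^{(μ+k)/2} e^{iθu}`
  for `u > 0` (Jacquet–Langlands (1970), §5: the Kirillov space of `σ(μ₁, μ₂)` consists of the functions
  `u ↦ u^{…} e^{-2πu} P(u)` on `u > 0`; Bump (1997), §2.8; Gelbart (1975), §4.B);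
* `apply_gardingAct_expGL_eq_zero_of_lowering` — if moreover `τ` acts by contractions and
  **`re(iθ) > 0`, then `f ≡ 0`**: `|f(y)| = |C| e^{re((μ+k)/2) y} e^{re(iθ) e^{y}}` is not of moderate
  growth (`exists_norm_apply_gardingAct_expGL_le`) unless `C = 0` — the Kirillov function of a lowest
  weight vector lives on ONE half-line (`θ = ∓2πi c`: on `c u > 0`);
* `integral_exp_mul_exp_neg_mul_cpow` / `exists_apply_gardingAct_expGL_eq_and_mellin_of_lowering` — for
  `iθ = -a`, `a > 0`, the Mellin transform
  **`∫₀^∞ ℓ(τ(diag(u,1)_w) v) u^{s - 1/2} du/u = C a^{-(s + (μ+k-1)/2)} Γ(s + (μ+k-1)/2)`** for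
  `re(s + (μ+k-1)/2) > 0` (`Complex.integral_cpow_mul_exp_neg_mul_Ioi`); for `a = 2π` this is
  `(C/2) Γ_ℂ(s + (μ+k-1)/2)` (`Complex.Gammaℂ`), the `L`-factor of the weight-`k` discrete series with
  central parameter `μ` (Jacquet–Langlands (1970), Thm. 5.15; Gelbart (1975), Thm. 6.16).

## References

* H. Jacquet, R. P. Langlands, *Automorphic Forms on GL(2)*, LNM 114 (1970), §5 (the representations
  `σ(μ₁, μ₂)`) and Thm. 5.15 (PDF pp. 120–129 of the held retypeset copy). [JacquetLanglands1970]
* D. Bump, *Automorphic Forms and Representations*, CUP 1997, §2.2 (raising and lowering operators),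
  §2.8. [Bump1997]
* D. Goldfeld, *Automorphic Forms and L-Functions for the Group GL(n,ℝ)*, CUP 2006, §3.4. [Goldfeld2006]
-/

noncomputable section

open MeasureTheory Measure NumberField NumberField.InfinitePlace NumberField.mixedEmbedding IsDedekindDomain Set Filter
open scoped MatrixGroups Topology Classical

namespace Literature.NumberTheory.Automorphic

variable {K : Type} [Field K] [NumberField K]

-- as in `ArchGardingWhittaker`
set_option backward.isDefEq.respectTransparency false

/-! ### 1. First order linear differential equations and the growth of `e^{α e^y}` -/

/-- **`f' = g f` and `G' = g` force `f = C e^{G}`** (the derivative of `f e^{-G}` vanishes). [folklore] -/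
theorem exists_eq_const_mul_exp_of_hasDerivAt {f g G : ℝ → ℂ} (hf : ∀ y, HasDerivAt f (g y * f y) y)
    (hG : ∀ y, HasDerivAt G (g y) y) : ∃ C : ℂ, ∀ y, f y = C * Complex.exp (G y) := by
  have hh : ∀ y, HasDerivAt (fun y => f y * Complex.exp (-G y)) 0 y := by
    intro y
    have h := (hf y).mul ((hG y).neg.cexp)
    exact h.congr_deriv (by ring)
  have hconst : ∀ y, f y * Complex.exp (-G y) = f 0 * Complex.exp (-G 0) := fun y =>
    is_const_of_deriv_eq_zero (fun y => (hh y).differentiableAt) (fun y => (hh y).deriv) y 0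
  refine ⟨f 0 * Complex.exp (-G 0), fun y => ?_⟩
  calc f y = f y * Complex.exp (-G y) * Complex.exp (G y) := by
        rw [mul_assoc, ← Complex.exp_add, neg_add_cancel, Complex.exp_zero, mul_one]
    _ = f 0 * Complex.exp (-G 0) * Complex.exp (G y) := by rw [hconst]

/-- `y ↦ (e^y : ℂ)` has derivative `e^y`. [folklore] -/
theorem hasDerivAt_ofReal_exp (y : ℝ) : HasDerivAt (fun x : ℝ => (Real.exp x : ℂ)) (Real.exp y : ℂ) y := by
  simpa using (Real.hasDerivAt_exp y).ofReal_comp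

/-- **`C e^{β y} e^{α e^{y}}` with `α > 0` is of moderate growth only if `C = 0`**: if
`|C| e^{β y} e^{α e^y} ≤ M e^{N y}` for all `y ≥ 0` then `C = 0`. [folklore] -/
theorem eq_zero_of_norm_mul_exp_exp_le {C : ℂ} {α β M N : ℝ} (hα : 0 < α)
    (h : ∀ y : ℝ, 0 ≤ y → ‖C‖ * Real.exp (β * y) * Real.exp (α * Real.exp y) ≤ M * Real.exp (N * y)) : C = 0 := by
  by_contra hC
  have hC' : 0 < ‖C‖ := norm_pos_iff.mpr hC
  -- choose `y₀ ≥ 1` with `α e^{y₀} ≥ (N - β) y₀ + L + 1`, `L = M / ‖C‖`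
  set B : ℝ := |N - β| with hB
  set L : ℝ := |M| / ‖C‖ with hL
  have hB0 : 0 ≤ B := abs_nonneg _
  have hL0 : 0 ≤ L := div_nonneg (abs_nonneg _) hC'.le
  set y₀ : ℝ := 4 * (B + L + 1) / α + 1 with hy₀
  have hy1 : 1 ≤ y₀ := by
    have : 0 ≤ 4 * (B + L + 1) / α := by positivity
    linarith
  have hy0 : 0 ≤ y₀ := by linarith
  -- `e^{y₀} ≥ (1 + y₀/2)^2 ≥ y₀^2 / 4`
  have hexp : y₀ ^ 2 / 4 ≤ Real.exp y₀ := by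
    have h1 : 1 + y₀ / 2 ≤ Real.exp (y₀ / 2) := by linarith [Real.add_one_le_exp (y₀ / 2)]
    have h10 : 0 ≤ 1 + y₀ / 2 := by linarith
    have h2 : (1 + y₀ / 2) ^ 2 ≤ Real.exp y₀ :=
      calc (1 + y₀ / 2) ^ 2 ≤ Real.exp (y₀ / 2) ^ 2 := pow_le_pow_left₀ h10 h1 2
        _ = Real.exp y₀ := by rw [← Real.exp_nat_mul]; congr 1; push_cast; ring
    nlinarith
  have hkey : B * y₀ + L + 1 ≤ α * Real.exp y₀ := by
    have h1 : α * (y₀ ^ 2 / 4) ≤ α * Real.exp y₀ := mul_le_mul_of_nonneg_left hexp hα.le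
    have h2 : α * y₀ = 4 * (B + L + 1) + α := by
      rw [hy₀, mul_add, mul_one, mul_div_assoc', mul_div_cancel_left₀ _ hα.ne']
    have h3 : α * (y₀ ^ 2 / 4) = (α * y₀ / 4) * y₀ := by ring
    nlinarith
  -- evaluate the hypothesis at `y₀`
  have hy := h y₀ hy0
  have hNy : N * y₀ ≤ β * y₀ + B * y₀ := by
    have : (N - β) * y₀ ≤ B * y₀ := mul_le_mul_of_nonneg_right (le_abs_self _) hy0
    linarith
  have hM : M ≤ ‖C‖ * L := by
    rw [hL, mul_div_cancel₀ _ hC'.ne']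
    exact le_abs_self M
  -- `‖C‖ e^{βy₀} e^{α e^{y₀}} ≥ ‖C‖ e^{βy₀} e^{B y₀ + L + 1} > M e^{N y₀}`
  have h1 : ‖C‖ * Real.exp (β * y₀) * Real.exp (B * y₀ + L + 1) ≤
      ‖C‖ * Real.exp (β * y₀) * Real.exp (α * Real.exp y₀) := by gcongr
  have h2 : M * Real.exp (N * y₀) ≤ ‖C‖ * L * Real.exp (β * y₀ + B * y₀) := by
    have := Real.exp_le_exp.mpr hNy
    have hE : 0 ≤ Real.exp (N * y₀) := (Real.exp_pos _).le
    calc M * Real.exp (N * y₀) ≤ ‖C‖ * L * Real.exp (N * y₀) := mul_le_mul_of_nonneg_right hM hE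
      _ ≤ ‖C‖ * L * Real.exp (β * y₀ + B * y₀) := by gcongr
  have h3 : ‖C‖ * L * Real.exp (β * y₀ + B * y₀) < ‖C‖ * Real.exp (β * y₀) * Real.exp (B * y₀ + L + 1) := by
    have hLe : L < Real.exp (L + 1) := by linarith [Real.add_one_le_exp (L + 1)]
    have : ‖C‖ * Real.exp (β * y₀) * Real.exp (B * y₀ + L + 1) =
        ‖C‖ * Real.exp (L + 1) * Real.exp (β * y₀ + B * y₀) := by
      rw [mul_assoc, mul_assoc, ← Real.exp_add, ← Real.exp_add]; congr 2; ring
    rw [this]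
    gcongr
  linarith

/-- `∫₀^∞ e^{β log u} e^{-a u} u^{s - 1/2 - 1} du = a^{-(s + β - 1/2)} Γ(s + β - 1/2)` for `a > 0`,
`re(s + β - 1/2) > 0` (Euler's integral, `Complex.integral_cpow_mul_exp_neg_mul_Ioi`). [folklore] -/
theorem integral_exp_mul_log_mul_exp_neg_mul_cpow {a : ℝ} (ha : 0 < a) {s β : ℂ} (hs : 0 < (s + β - 1 / 2).re) :
    ∫ u in Ioi (0 : ℝ), Complex.exp (β * (Real.log u : ℂ) + -(a : ℂ) * (u : ℂ)) * (u : ℂ) ^ (s - 1 / 2 - 1) =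
      (1 / (a : ℂ)) ^ (s + β - 1 / 2) * Complex.Gamma (s + β - 1 / 2) := by
  rw [← Complex.integral_cpow_mul_exp_neg_mul_Ioi hs ha]
  refine setIntegral_congr_fun measurableSet_Ioi fun u hu => ?_
  have hu0 : (u : ℂ) ≠ 0 := Complex.ofReal_ne_zero.mpr (ne_of_gt hu)
  rw [Complex.exp_add, Complex.ofReal_log hu.le, mul_comm β, ← Complex.cpow_def_of_ne_zero hu0,
    show s + β - 1 / 2 - 1 = β + (s - 1 / 2 - 1) by ring, Complex.cpow_add _ _ hu0]
  ring_nf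

section RealPlace

variable {hcpt : isCompact_glFiniteIntegralLevel 2 K}
  {E : Type*} [NormedAddCommGroup E] [NormedSpace ℂ E] [CompleteSpace E]
  {τ : ContRepresentation ℂ (AutomorphyDatum.gl 2 K hcpt).arch.carrier E}
  (hτ : τ.IsStronglyContinuous) (w : {w : InfinitePlace K // IsReal w})

local notation "H₀" => Matrix.single (0 : Fin 2) (0 : Fin 2) ((Pi.single w 1, 0) : mixedSpace K)
local notation "H₁" => Matrix.single (1 : Fin 2) (1 : Fin 2) ((Pi.single w 1, 0) : mixedSpace K)
local notation "X⁺" => Matrix.single (0 : Fin 2) (1 : Fin 2) ((Pi.single w 1, 0) : mixedSpace K)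
local notation "X⁻" => Matrix.single (1 : Fin 2) (0 : Fin 2) ((Pi.single w 1, 0) : mixedSpace K)
local notation "D" => gardingEnd (hcpt := hcpt) (τ := τ) hτ
local notation "A[" y "]" => gardingAct (hcpt := hcpt) (τ := τ) hτ (expGL ((y : ℝ) • H₀))

/-! ### 2. The first order differential equation of a lowest / highest weight vector -/

/-- `ℓ(τ(exp yH₀) τ(X⁺) u) = e^{y} θ ℓ(τ(exp yH₀) u)` (`Ad(exp yH₀) X⁺ = e^{y} X⁺`). [folklore] -/
theorem apply_gardingAct_expGL_xPlus {ℓ : archGardingSpace hcpt τ →ₗ[ℂ] ℂ} {θ : ℂ}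
    (hθ : ∀ u : archGardingSpace hcpt τ, ℓ (D X⁺ u) = θ * ℓ u) (u : archGardingSpace hcpt τ) (y : ℝ) :
    ℓ (A[y] (D X⁺ u)) = (Real.exp y : ℂ) * θ * ℓ (A[y] u) := by
  have h1 := congrArg (fun T => ℓ (T u)) (gardingAct_expGL_mul_xPlus (hcpt := hcpt) (τ := τ) hτ w y)
  simp only [Module.End.mul_apply, LinearMap.smul_apply, map_smul, smul_eq_mul] at h1
  rw [h1, hθ, mul_assoc]

/-- **The differential equation of a lowest weight vector.** If `τ(L) v = 0` for the lowering element
`L = (H₀ - H₁) - i(X⁺ + X⁻)`, `τ(W) v = ik v` and `τ(H₀) v + τ(H₁) v = μ v`, then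
`f(y) = ℓ(τ(exp yH₀) v)` satisfies `f'(y) = ((μ + k)/2 + iθ e^{y}) f(y)`.
[cite: JacquetLanglands1970, §5 and Thm. 5.15] [cite: Bump1997, §2.2 and §2.8] -/
theorem hasDerivAt_apply_gardingAct_expGL_of_lowering {ℓ : archGardingSpace hcpt τ →ₗ[ℂ] ℂ}
    (hℓ : ∃ (C : ℝ) (𝒮 : Finset (List (Matrix (Fin 2) (Fin 2) (mixedSpace K)))), 0 ≤ C ∧
      ∀ v : archGardingSpace hcpt τ, ‖ℓ v‖ ≤ C * ∑ w ∈ 𝒮, ‖archWordDerivE hcpt τ w v‖)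
    {θ : ℂ} (hθ : ∀ u : archGardingSpace hcpt τ, ℓ (D X⁺ u) = θ * ℓ u)
    (k μ : ℂ) (v : archGardingSpace hcpt τ)
    (hW : D (X⁺ - X⁻) v = (Complex.I * k) • v) (hZ : D H₀ v + D H₁ v = μ • v)
    (hL : D (H₀ - H₁) v - Complex.I • D (X⁺ + X⁻) v = 0) (y : ℝ) :
    HasDerivAt (fun x : ℝ => ℓ (A[x] v)) (((μ + k) / 2 + Complex.I * θ * (Real.exp y : ℂ)) * ℓ (A[y] v)) y := by
  have hd := hasDerivAt_apply_gardingAct_expGL hτ w hℓ v y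
  convert hd using 1
  have h1 := congrArg (fun u : archGardingSpace hcpt τ => ℓ (A[y] u)) hL
  have h2 := congrArg (fun u : archGardingSpace hcpt τ => ℓ (A[y] u)) hZ
  have h3 := congrArg (fun u : archGardingSpace hcpt τ => ℓ (A[y] u)) hW
  simp only [gardingEnd_sub, gardingEnd_add, LinearMap.sub_apply, LinearMap.add_apply, map_sub, map_add,
    map_smul, smul_eq_mul, map_zero] at h1 h2 h3
  have hX := apply_gardingAct_expGL_xPlus hτ w hθ v y
  linear_combination (-(1 : ℂ) / 2) * h1 - (1 / 2) * h2 + (Complex.I / 2) * h3 - Complex.I * hX +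
    (k * ℓ (A[y] v) / 2) * Complex.I_sq

/-- **The differential equation of a highest weight vector**: `τ(R) v = 0`, `R = (H₀ - H₁) + i(X⁺ + X⁻)`,
gives `f'(y) = ((μ - k)/2 - iθ e^{y}) f(y)`. [cite: JacquetLanglands1970, §5 and Thm. 5.15]
[cite: Bump1997, §2.2 and §2.8] -/
theorem hasDerivAt_apply_gardingAct_expGL_of_raising {ℓ : archGardingSpace hcpt τ →ₗ[ℂ] ℂ}
    (hℓ : ∃ (C : ℝ) (𝒮 : Finset (List (Matrix (Fin 2) (Fin 2) (mixedSpace K)))), 0 ≤ C ∧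
      ∀ v : archGardingSpace hcpt τ, ‖ℓ v‖ ≤ C * ∑ w ∈ 𝒮, ‖archWordDerivE hcpt τ w v‖)
    {θ : ℂ} (hθ : ∀ u : archGardingSpace hcpt τ, ℓ (D X⁺ u) = θ * ℓ u)
    (k μ : ℂ) (v : archGardingSpace hcpt τ)
    (hW : D (X⁺ - X⁻) v = (Complex.I * k) • v) (hZ : D H₀ v + D H₁ v = μ • v)
    (hR : D (H₀ - H₁) v + Complex.I • D (X⁺ + X⁻) v = 0) (y : ℝ) :
    HasDerivAt (fun x : ℝ => ℓ (A[x] v)) (((μ - k) / 2 - Complex.I * θ * (Real.exp y : ℂ)) * ℓ (A[y] v)) y := by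
  have hd := hasDerivAt_apply_gardingAct_expGL hτ w hℓ v y
  convert hd using 1
  have h1 := congrArg (fun u : archGardingSpace hcpt τ => ℓ (A[y] u)) hR
  have h2 := congrArg (fun u : archGardingSpace hcpt τ => ℓ (A[y] u)) hZ
  have h3 := congrArg (fun u : archGardingSpace hcpt τ => ℓ (A[y] u)) hW
  simp only [gardingEnd_sub, gardingEnd_add, LinearMap.sub_apply, LinearMap.add_apply, map_sub, map_add,
    map_smul, smul_eq_mul, map_zero] at h1 h2 h3
  have hX := apply_gardingAct_expGL_xPlus hτ w hθ v y
  linear_combination (-(1 : ℂ) / 2) * h1 - (1 / 2) * h2 - (Complex.I / 2) * h3 + Complex.I * hX -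
    (k * ℓ (A[y] v) / 2) * Complex.I_sq

/-! ### 3. The Kirillov function of a lowest weight vector -/

/-- **The Kirillov function of a lowest weight vector along a real place** is
`ℓ(τ(exp yH₀) v) = C exp(((μ + k)/2) y + iθ e^{y})`, i.e. `ℓ(τ(diag(u, 1)_w) v) = C u^{(μ+k)/2} e^{iθu}`
for `u > 0` (Jacquet–Langlands (1970), §5: the Kirillov model of `σ(μ₁, μ₂)`; Bump (1997), §2.8).
[cite: JacquetLanglands1970, §5 and Thm. 5.15] [cite: Bump1997, §2.8] -/
theorem exists_apply_gardingAct_expGL_eq_of_lowering {ℓ : archGardingSpace hcpt τ →ₗ[ℂ] ℂ}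
    (hℓ : ∃ (C : ℝ) (𝒮 : Finset (List (Matrix (Fin 2) (Fin 2) (mixedSpace K)))), 0 ≤ C ∧
      ∀ v : archGardingSpace hcpt τ, ‖ℓ v‖ ≤ C * ∑ w ∈ 𝒮, ‖archWordDerivE hcpt τ w v‖)
    {θ : ℂ} (hθ : ∀ u : archGardingSpace hcpt τ, ℓ (D X⁺ u) = θ * ℓ u)
    (k μ : ℂ) (v : archGardingSpace hcpt τ)
    (hW : D (X⁺ - X⁻) v = (Complex.I * k) • v) (hZ : D H₀ v + D H₁ v = μ • v)
    (hL : D (H₀ - H₁) v - Complex.I • D (X⁺ + X⁻) v = 0) :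
    ∃ C : ℂ, ∀ y : ℝ, ℓ (A[y] v) = C * Complex.exp ((μ + k) / 2 * y + Complex.I * θ * (Real.exp y : ℂ)) := by
  refine exists_eq_const_mul_exp_of_hasDerivAt (f := fun x : ℝ => ℓ (A[x] v))
    (g := fun y : ℝ => (μ + k) / 2 + Complex.I * θ * (Real.exp y : ℂ))
    (G := fun y : ℝ => (μ + k) / 2 * y + Complex.I * θ * (Real.exp y : ℂ))
    (hasDerivAt_apply_gardingAct_expGL_of_lowering hτ w hℓ hθ k μ v hW hZ hL) fun y => ?_
  have h := ((hasDerivAt_id y).ofReal_comp.const_mul ((μ + k) / 2)).add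
    ((hasDerivAt_ofReal_exp y).const_mul (Complex.I * θ))
  exact h.congr_deriv (by push_cast; ring)

/-- Dually, **the Kirillov function of a highest weight vector** is `C exp(((μ - k)/2) y - iθ e^{y})`.
[cite: JacquetLanglands1970, §5 and Thm. 5.15] [cite: Bump1997, §2.8] -/
theorem exists_apply_gardingAct_expGL_eq_of_raising {ℓ : archGardingSpace hcpt τ →ₗ[ℂ] ℂ}
    (hℓ : ∃ (C : ℝ) (𝒮 : Finset (List (Matrix (Fin 2) (Fin 2) (mixedSpace K)))), 0 ≤ C ∧
      ∀ v : archGardingSpace hcpt τ, ‖ℓ v‖ ≤ C * ∑ w ∈ 𝒮, ‖archWordDerivE hcpt τ w v‖)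
    {θ : ℂ} (hθ : ∀ u : archGardingSpace hcpt τ, ℓ (D X⁺ u) = θ * ℓ u)
    (k μ : ℂ) (v : archGardingSpace hcpt τ)
    (hW : D (X⁺ - X⁻) v = (Complex.I * k) • v) (hZ : D H₀ v + D H₁ v = μ • v)
    (hR : D (H₀ - H₁) v + Complex.I • D (X⁺ + X⁻) v = 0) :
    ∃ C : ℂ, ∀ y : ℝ, ℓ (A[y] v) = C * Complex.exp ((μ - k) / 2 * y - Complex.I * θ * (Real.exp y : ℂ)) := by
  refine exists_eq_const_mul_exp_of_hasDerivAt (f := fun x : ℝ => ℓ (A[x] v))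
    (g := fun y : ℝ => (μ - k) / 2 - Complex.I * θ * (Real.exp y : ℂ))
    (G := fun y : ℝ => (μ - k) / 2 * y - Complex.I * θ * (Real.exp y : ℂ))
    (hasDerivAt_apply_gardingAct_expGL_of_raising hτ w hℓ hθ k μ v hW hZ hR) fun y => ?_
  have h := ((hasDerivAt_id y).ofReal_comp.const_mul ((μ - k) / 2)).sub
    ((hasDerivAt_ofReal_exp y).const_mul (Complex.I * θ))
  exact h.congr_deriv (by push_cast; ring)

/-- **A lowest weight vector with `re(iθ) > 0` has vanishing Kirillov function on the positive
half-torus**: for `τ` acting by contractions, `ℓ(τ(exp yH₀) v) = 0` for all `y` (the solution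
`C e^{(μ+k)y/2} e^{iθ e^y}` is of moderate growth — `exists_norm_apply_gardingAct_expGL_le` — only for
`C = 0`). With the opposite sign the function lives on `u > 0` and vanishes on `u < 0`: the Kirillov
functions of the discrete series are supported on a half-line (Jacquet–Langlands (1970), §5).
[cite: JacquetLanglands1970, §5 and Thm. 5.15] -/
theorem apply_gardingAct_expGL_eq_zero_of_lowering (hτb : ∀ g, ‖(τ g : E →L[ℂ] E)‖ ≤ 1)
    {ℓ : archGardingSpace hcpt τ →ₗ[ℂ] ℂ}
    (hℓ : ∃ (C : ℝ) (𝒮 : Finset (List (Matrix (Fin 2) (Fin 2) (mixedSpace K)))), 0 ≤ C ∧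
      ∀ v : archGardingSpace hcpt τ, ‖ℓ v‖ ≤ C * ∑ w ∈ 𝒮, ‖archWordDerivE hcpt τ w v‖)
    {θ : ℂ} (hθ : ∀ u : archGardingSpace hcpt τ, ℓ (D X⁺ u) = θ * ℓ u) (hθi : 0 < (Complex.I * θ).re)
    (k μ : ℂ) (v : archGardingSpace hcpt τ)
    (hW : D (X⁺ - X⁻) v = (Complex.I * k) • v) (hZ : D H₀ v + D H₁ v = μ • v)
    (hL : D (H₀ - H₁) v - Complex.I • D (X⁺ + X⁻) v = 0) (y : ℝ) :
    ℓ (A[y] v) = 0 := by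
  obtain ⟨C, hC⟩ := exists_apply_gardingAct_expGL_eq_of_lowering hτ w hℓ hθ k μ v hW hZ hL
  obtain ⟨M, N, -, hgrow⟩ := exists_norm_apply_gardingAct_expGL_le hτ w hτb hℓ v
  have hC0 : C = 0 := by
    refine eq_zero_of_norm_mul_exp_exp_le (β := ((μ + k) / 2).re) (M := M) (N := N) hθi fun x hx => ?_
    have h := hgrow x
    rw [abs_of_nonneg hx, hC x, norm_mul, Complex.norm_exp, Complex.add_re, Complex.re_mul_ofReal,
      Complex.re_mul_ofReal, Real.exp_add, ← mul_assoc] at h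
    exact h
  rw [hC y, hC0, zero_mul]

/-! ### 4. The Mellin transform: a single Gamma function -/

/-- **The Kirillov function of a lowest weight vector and its Mellin transform.** If `iθ = -a` with
`a > 0` (e.g. `θ = ia`; for the standard `ψ_∞`, `a = 2π`), then `ℓ(τ(exp yH₀) v) = C e^{(μ+k)y/2} e^{-a e^y}`
and, for `re(s + (μ + k - 1)/2) > 0`,

  `∫₀^∞ ℓ(τ(exp((log u) H₀)) v) u^{s - 1/2} du/u = C a^{-(s + (μ+k-1)/2)} Γ(s + (μ+k-1)/2)`

(Euler's integral) — a single Gamma function; for `a = 2π` it is `(C/2) Γ_ℂ(s + (μ+k-1)/2)`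
(`Complex.Gammaℂ s = 2 (2π)^{-s} Γ(s)`), the `L`-factor of the discrete series of weight `k` and
central parameter `μ` (Jacquet–Langlands (1970), Thm. 5.15; Gelbart (1975), Thm. 6.16).
[cite: JacquetLanglands1970, Thm. 5.15] [cite: Bump1997, §2.8] -/
theorem exists_apply_gardingAct_expGL_eq_and_mellin_of_lowering {ℓ : archGardingSpace hcpt τ →ₗ[ℂ] ℂ}
    (hℓ : ∃ (C : ℝ) (𝒮 : Finset (List (Matrix (Fin 2) (Fin 2) (mixedSpace K)))), 0 ≤ C ∧
      ∀ v : archGardingSpace hcpt τ, ‖ℓ v‖ ≤ C * ∑ w ∈ 𝒮, ‖archWordDerivE hcpt τ w v‖)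
    {θ : ℂ} (hθ : ∀ u : archGardingSpace hcpt τ, ℓ (D X⁺ u) = θ * ℓ u)
    {a : ℝ} (ha : 0 < a) (hθa : Complex.I * θ = -(a : ℂ))
    (k μ : ℂ) (v : archGardingSpace hcpt τ)
    (hW : D (X⁺ - X⁻) v = (Complex.I * k) • v) (hZ : D H₀ v + D H₁ v = μ • v)
    (hL : D (H₀ - H₁) v - Complex.I • D (X⁺ + X⁻) v = 0) :
    ∃ C : ℂ, (∀ y : ℝ, ℓ (A[y] v) = C * Complex.exp ((μ + k) / 2 * y + -(a : ℂ) * (Real.exp y : ℂ))) ∧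
      ∀ s : ℂ, 0 < (s + (μ + k) / 2 - 1 / 2).re →
        ∫ u in Ioi (0 : ℝ), ℓ (A[Real.log u] v) * (u : ℂ) ^ (s - 1 / 2 - 1) =
          C * ((1 / (a : ℂ)) ^ (s + (μ + k) / 2 - 1 / 2) * Complex.Gamma (s + (μ + k) / 2 - 1 / 2)) := by
  obtain ⟨C, hC⟩ := exists_apply_gardingAct_expGL_eq_of_lowering hτ w hℓ hθ k μ v hW hZ hL
  simp_rw [hθa] at hC
  refine ⟨C, hC, fun s hs => ?_⟩
  rw [← integral_exp_mul_log_mul_exp_neg_mul_cpow ha hs, ← MeasureTheory.integral_const_mul]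
  refine setIntegral_congr_fun measurableSet_Ioi fun u hu => ?_
  rw [hC (Real.log u), Real.exp_log hu, mul_assoc]

/-- The `a = 2π` normalisation: `(1/(2π))^{z} Γ(z) = ½ Γ_ℂ(z)`. [folklore] -/
theorem one_div_two_pi_cpow_mul_Gamma (z : ℂ) :
    (1 / ((2 * Real.pi : ℝ) : ℂ)) ^ z * Complex.Gamma z = (1 / 2 : ℂ) * Complex.Gammaℂ z := by
  rw [Complex.Gammaℂ_def, one_div, Complex.inv_cpow _ _ ?_, ← Complex.cpow_neg]
  · push_cast; ring
  · rw [show ((2 * Real.pi : ℝ) : ℂ) = ((2 * Real.pi : ℝ) : ℂ) from rfl, Complex.arg_ofReal_of_nonneg (by positivity)]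
    exact Real.pi_pos.ne

end RealPlace

end Literature.NumberTheory.Automorphic
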